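import Summits.Ventures.PercRepro.SixThreeProfile

/-!
# PercRepro — the profile lower bound, part B: sizes `s ≥ 5`, the assembly `sum_R3_ge_Fsum`, realisability facts, `card_R3_eq_sum`, `gprime_ge` (p2, gen 6)

Continuation of `SixThreeProfile.lean` (split for the 400-line file limit; proofs unchanged).
-/

namespace PercRepro

namespace SixThree

open Finset ThmH

variable {α : Type*} [DecidableEq α] {M : Matroid α} [M.Finite]

/-- `C(s, 2) ≤ 6 · C(s − 3, 2)` for `s ≥ 6`. -/
theorem choose_le_six_choose_sub_three (s : ℕ) (hs : 6 ≤ s) : s.choose 2 ≤ 6 * (s - 3).choose 2 := by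
  obtain ⟨n, rfl⟩ : ∃ n, s = n + 6 := ⟨s - 6, by omega⟩
  rw [Nat.choose_two_right, show n + 6 - 3 = n + 3 by omega, Nat.choose_two_right,
    show n + 6 - 1 = n + 5 from rfl, show n + 3 - 1 = n + 2 from rfl]
  have hev1 : Even ((n + 6) * (n + 5)) := by rw [mul_comm]; exact Nat.even_mul_succ_self (n + 5)
  have hev2 : Even ((n + 3) * (n + 2)) := by rw [mul_comm]; exact Nat.even_mul_succ_self (n + 2)
  have e1 := Nat.two_mul_div_two_of_even hev1
  have e2 := Nat.two_mul_div_two_of_even hev2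
  nlinarith [e1, e2]

/-- `Λ_rest(s) ≤ Λ_d(s)` for `s ≥ 5` (so `v^{d} ≤ v^{rest}`). -/
theorem Lrest_le_Ld {s : ℕ} (hs : 5 ≤ s) : Lrest s ≤ Ld s := by
  unfold Lrest Ld
  rcases Nat.eq_or_lt_of_le hs with h5 | h6
  · rw [← h5]
    norm_num [Nat.choose]
  · have hc := choose_le_six_choose_sub_three s h6
    have hc' : ((s.choose 2 : ℕ) : ℚ) ≤ 6 * (((s - 3).choose 2 : ℕ) : ℚ) := by exact_mod_cast hc
    have hpos : (0 : ℚ) < (((s - 3).choose 2 : ℕ) : ℚ) := by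
      have : 0 < (s - 3).choose 2 := Nat.choose_pos (by omega)
      exact_mod_cast this
    have hp : (0 : ℚ) ≤ (6 : ℚ) ^ (s - 5) := by positivity
    have hpow : (6 : ℚ) ^ (s - 4) = 6 * (6 : ℚ) ^ (s - 5) := by
      rw [show s - 4 = (s - 5) + 1 by omega, pow_succ]; ring
    rw [div_le_iff₀ hpos, hpow]
    have hs' : (0 : ℚ) ≤ (s : ℚ) := by positivity
    nlinarith [mul_le_mul_of_nonneg_left hc' hp, mul_nonneg hs' hpos.le]

/-- `Lrest s ≥ 0`, `Ld s ≥ 0`. -/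
theorem Lrest_nonneg (s : ℕ) : 0 ≤ Lrest s := by unfold Lrest; positivity

/-- A rank-`3` `s`-set (`s ≥ 5`) with no line through `s − 1` or `s − 2` of its points has `Λ ≤ Λ_rest(s)`. -/
theorem Lam_le_Lrest (hs : Simple M) {G B : Finset α} (hG : G ∈ planes M) (hB : B ⊆ G)
    (hrB : M.eRk (B : Set α) = 3) {s : ℕ} (hs5 : 5 ≤ s) (hBs : B.card = s)
    (h1 : ¬ ∃ L ∈ linesOf M G, (L ∩ B).card = s - 1) (h2 : ¬ ∃ L ∈ linesOf M G, (L ∩ B).card = s - 2) :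
    Lam M B ≤ Lrest s := by
  have hGg : G ⊆ gr M := (mem_planes.1 hG).1
  have hsmall : ∀ L ∈ linesOf M B, (L ∩ B).card ≤ s - 3 := by
    intro L hL
    have hle := card_inter_le_of_linesOf hrB hL
    have hk2 : 2 ≤ (L ∩ B).card := (Finset.mem_filter.1 hL).2
    by_contra hgt
    push Not at hgt
    have hL' := linesOf_mono hB hL
    rcases (show (L ∩ B).card = s - 1 ∨ (L ∩ B).card = s - 2 by omega) with h | h
    · exact h1 ⟨L, hL', h⟩
    · exact h2 ⟨L, hL', h⟩
  have h := Lam_mul_choose_le hs (hB.trans hGg) hsmall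
  rw [hBs] at h
  unfold Lrest
  have hpos : (0 : ℚ) < (((s - 3).choose 2 : ℕ) : ℚ) := by
    have : 0 < (s - 3).choose 2 := Nat.choose_pos (by omega)
    exact_mod_cast this
  rw [le_div_iff₀ hpos]
  rw [show s - 3 - 2 = s - 5 by omega] at h
  linarith

/-- **Size `s ≥ 5`**: `Σ_{B ∈ R₃, |B| = s} v(B, n) ≥ lp_s · v^{lp} + d_s · v^{d} + rest_s · v^{rest}`. -/
theorem sum_R3s_ge (hs : Simple M) {G : Finset α} (hG : G ∈ planes M) {s : ℕ} (hs5 : 5 ≤ s) {n : ℕ}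
    (hn : 2 ≤ n) :
    (lps G.card (prof M G) s : ℚ) * vlp n s + (ds G.card (prof M G) s : ℚ) * vd n s +
      (rests G.card (prof M G) s : ℚ) * vrest n s ≤ ∑ B ∈ R3s M G s, vSupply M B n := by
  classical
  have hGg : G ⊆ gr M := (mem_planes.1 hG).1
  -- the card facts, stated before abbreviating the classes
  have hc1 := Finset.card_filter_add_card_filter_not (s := R3s M G s)
    (p := fun B : Finset α => ∃ L ∈ linesOf M G, (L ∩ B).card = s - 1)
  have hc2 := Finset.card_filter_add_card_filter_not
    (s := (R3s M G s).filter (fun B : Finset α => ¬ ∃ L ∈ linesOf M G, (L ∩ B).card = s - 1))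
    (p := fun B : Finset α => ∃ L ∈ linesOf M G, (L ∩ B).card = s - 2)
  have hsplit1 := Finset.sum_filter_add_sum_filter_not (R3s M G s)
    (fun B : Finset α => ∃ L ∈ linesOf M G, (L ∩ B).card = s - 1) (fun B => vSupply M B n)
  have hsplit2 := Finset.sum_filter_add_sum_filter_not
    ((R3s M G s).filter (fun B : Finset α => ¬ ∃ L ∈ linesOf M G, (L ∩ B).card = s - 1))
    (fun B : Finset α => ∃ L ∈ linesOf M G, (L ∩ B).card = s - 2) (fun B => vSupply M B n)
  have hLPcard : ((R3s M G s).filter (fun B : Finset α => ∃ L ∈ linesOf M G, (L ∩ B).card = s - 1)).card =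
      lps G.card (prof M G) s := card_R3s_lp hs hG (by omega)
  have hN : (R3s M G s).card = Ns G.card (prof M G) s := card_R3s hs hG (by omega)
  -- the three classes
  set LP := (R3s M G s).filter (fun B : Finset α => ∃ L ∈ linesOf M G, (L ∩ B).card = s - 1) with hLP
  set NLP := (R3s M G s).filter (fun B : Finset α => ¬ ∃ L ∈ linesOf M G, (L ∩ B).card = s - 1) with hNLP
  set DT := NLP.filter (fun B : Finset α => ∃ L ∈ linesOf M G, (L ∩ B).card = s - 2) with hDT
  set RS := NLP.filter (fun B : Finset α => ¬ ∃ L ∈ linesOf M G, (L ∩ B).card = s - 2) with hRS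
  -- membership data
  have hmem : ∀ B ∈ R3s M G s, B ⊆ G ∧ B.card = s ∧ M.eRk (B : Set α) = 3 := by
    intro B hB
    unfold R3s at hB
    rw [Finset.mem_filter, Finset.mem_powersetCard] at hB
    exact ⟨hB.1.1, hB.1.2, hB.2⟩
  -- per-class value bounds
  have hLPv : ∀ B ∈ LP, vlp n s ≤ vSupply M B n := by
    intro B hB
    rw [hLP, Finset.mem_filter] at hB
    obtain ⟨hBG, hBs, hrB⟩ := hmem B hB.1
    have hΛ := Lam_le hs (hBG.trans hGg) hrB (by omega)
    rw [hBs] at hΛ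
    have := vSupply_ge_of_Lam_le M (by omega) hn hΛ
    rw [hBs] at this
    unfold vlp Llp
    exact this
  have hDTv : ∀ B ∈ DT, vd n s ≤ vSupply M B n := by
    intro B hB
    rw [hDT, Finset.mem_filter, hNLP, Finset.mem_filter] at hB
    obtain ⟨hBG, hBs, hrB⟩ := hmem B hB.1.1
    obtain ⟨L, hL, hLB⟩ := hB.2
    have hLB' : L ∈ linesOf M B := by
      unfold linesOf
      rw [Finset.mem_filter]
      exact ⟨(Finset.mem_filter.1 hL).1, by omega⟩
    have hΛ := Lam_le_of_long_line hs (hBG.trans hGg) (by omega) hLB' (by rw [hLB, hBs])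
    rw [hBs] at hΛ
    have := vSupply_ge_of_Lam_le M (by omega) hn hΛ
    rw [hBs] at this
    unfold vd Ld
    exact this
  have hRSv : ∀ B ∈ RS, vrest n s ≤ vSupply M B n := by
    intro B hB
    rw [hRS, Finset.mem_filter, hNLP, Finset.mem_filter] at hB
    obtain ⟨hBG, hBs, hrB⟩ := hmem B hB.1.1
    have hΛ := Lam_le_Lrest hs hG hBG hrB hs5 hBs hB.1.2 hB.2
    have := vSupply_ge_of_Lam_le M (by omega) hn hΛ
    rw [hBs] at this
    unfold vrest
    exact this
  -- the counts
  have hDTle : DT.card ≤ ds G.card (prof M G) s := by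
    unfold ds
    apply le_min
    · have hsub : DT ⊆ (G.powersetCard s).filter (fun X : Finset α => ∃ L ∈ linesOf M G, (L ∩ X).card = s - 2) := by
        intro B hB
        rw [hDT, Finset.mem_filter, hNLP, Finset.mem_filter] at hB
        obtain ⟨hBG, hBs, -⟩ := hmem B hB.1.1
        rw [Finset.mem_filter, Finset.mem_powersetCard]
        exact ⟨⟨hBG, hBs⟩, hB.2⟩
      have h := (Finset.card_le_card hsub).trans (card_line_plus_subsets_le (M := M) (G := G) (s := s) (j := 2) (by omega))
      rw [sum_prof_eq (M := M) G (fun m => m.choose (s - 2) * (G.card - m).choose 2)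
        (by rw [Nat.choose_eq_zero_of_lt (by omega)]; ring)]
      exact h
    · have : DT.card ≤ NLP.card := Finset.card_le_card (Finset.filter_subset _ _)
      omega
  have hRScard : RS.card = Ns G.card (prof M G) s - lps G.card (prof M G) s - DT.card := by omega
  -- assemble
  have hvals : vd n s ≤ vrest n s := by
    unfold vd vrest
    exact vFun_antitone hn (Lrest_nonneg s) (Lrest_le_Ld hs5)
  have hsumLP : (LP.card : ℚ) * vlp n s ≤ ∑ B ∈ LP, vSupply M B n := by
    rw [← nsmul_eq_mul, ← Finset.sum_const]; exact Finset.sum_le_sum hLPv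
  have hsumDT : (DT.card : ℚ) * vd n s ≤ ∑ B ∈ DT, vSupply M B n := by
    rw [← nsmul_eq_mul, ← Finset.sum_const]; exact Finset.sum_le_sum hDTv
  have hsumRS : (RS.card : ℚ) * vrest n s ≤ ∑ B ∈ RS, vSupply M B n := by
    rw [← nsmul_eq_mul, ← Finset.sum_const]; exact Finset.sum_le_sum hRSv
  have htot : ∑ B ∈ R3s M G s, vSupply M B n = ∑ B ∈ LP, vSupply M B n + ∑ B ∈ DT, vSupply M B n +
      ∑ B ∈ RS, vSupply M B n := by
    rw [← hsplit1, ← hsplit2, add_assoc]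
  rw [htot]
  -- numeric closing: `#DT ≤ d_s`, `#RS = N − lp − #DT`, `v^d ≤ v^rest`
  have hdsle : ds G.card (prof M G) s ≤ Ns G.card (prof M G) s - lps G.card (prof M G) s := min_le_right _ _
  have hRSq : (RS.card : ℚ) = ((Ns G.card (prof M G) s - lps G.card (prof M G) s : ℕ) : ℚ) - DT.card := by
    rw [hRScard]
    have : DT.card ≤ Ns G.card (prof M G) s - lps G.card (prof M G) s := hDTle.trans hdsle
    rw [Nat.cast_sub this]
  have hrestq : (rests G.card (prof M G) s : ℚ) =
      ((Ns G.card (prof M G) s - lps G.card (prof M G) s : ℕ) : ℚ) - ds G.card (prof M G) s := by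
    unfold rests
    rw [Nat.cast_sub hdsle]
  have hDTq : (DT.card : ℚ) ≤ ds G.card (prof M G) s := by exact_mod_cast hDTle
  rw [hLPcard] at hsumLP
  calc (lps G.card (prof M G) s : ℚ) * vlp n s + (ds G.card (prof M G) s : ℚ) * vd n s +
        (rests G.card (prof M G) s : ℚ) * vrest n s
      ≤ (lps G.card (prof M G) s : ℚ) * vlp n s + (DT.card : ℚ) * vd n s + (RS.card : ℚ) * vrest n s := by
        rw [hrestq, hRSq]
        nlinarith [mul_le_mul_of_nonneg_right hDTq (sub_nonneg.2 hvals)]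
    _ ≤ _ := add_le_add (add_le_add hsumLP hsumDT) hsumRS

omit [DecidableEq α] in
/-- The size-`s` slice of `R₃(G)` is `R3s`. -/
theorem R3_filter_card (G : Finset α) (s : ℕ) :
    (R3 M G).filter (fun B : Finset α => B.card = s) = R3s M G s := by
  ext B
  unfold R3 R3s
  rw [Finset.mem_filter, Finset.mem_filter, Finset.mem_powerset, Finset.mem_filter, Finset.mem_powersetCard]
  tauto

/-- **The profile lower bound** (mine-2 §19.7 Step 3): for a plane `G` with `g ≥ 4` points,
`Σ_{B ∈ R₃(G)} v(B, n) ≥ F(n, g, prof(G))`. -/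
theorem sum_R3_ge_Fsum (hs : Simple M) {G : Finset α} (hG : G ∈ planes M) (hg4 : 4 ≤ G.card) {n : ℕ}
    (hn : 2 ≤ n) : Fsum n G.card (prof M G) ≤ ∑ B ∈ R3 M G, vSupply M B n := by
  classical
  have hGg : G ⊆ gr M := (mem_planes.1 hG).1
  -- fibre by size
  have hmaps : ∀ B ∈ R3 M G, B.card ∈ Finset.Icc 3 G.card := by
    intro B hB
    unfold R3 at hB
    rw [Finset.mem_filter, Finset.mem_powerset] at hB
    rw [Finset.mem_Icc]
    exact ⟨three_le_card_of_eRk_eq_three hB.2, Finset.card_le_card hB.1⟩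
  rw [← Finset.sum_fiberwise_of_maps_to hmaps]
  simp_rw [R3_filter_card]
  -- split `Icc 3 g = {3} ∪ {4} ∪ Icc 5 g`
  have hIcc : Finset.Icc 3 G.card = insert 3 (insert 4 (Finset.Icc 5 G.card)) := by
    ext x; simp only [Finset.mem_Icc, Finset.mem_insert]; omega
  rw [hIcc, Finset.sum_insert (by simp), Finset.sum_insert (by simp)]
  have h3 := sum_R3s_three hs hG n
  have h4 := sum_R3s_four hs hG hn
  have h5 : ∑ s ∈ Finset.Icc 5 G.card, ((lps G.card (prof M G) s : ℚ) * vlp n s + (ds G.card (prof M G) s : ℚ) * vd n s +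
      (rests G.card (prof M G) s : ℚ) * vrest n s) ≤ ∑ s ∈ Finset.Icc 5 G.card, ∑ B ∈ R3s M G s, vSupply M B n := by
    apply Finset.sum_le_sum
    intro s hs'
    rw [Finset.mem_Icc] at hs'
    exact sum_R3s_ge hs hG hs'.1 hn
  unfold Fsum
  rw [h3]
  linarith

/-! ### Realisability facts on the profile, and the demands as profile formulas -/

/-- `Σ_{m ∈ prof} C(m, 2) ≤ C(g, 2)`. -/
theorem prof_sum_choose_le (hs : Simple M) {G : Finset α} (hG : G ∈ planes M) :
    (Multiset.map (fun m => m.choose 2) (prof M G)).sum ≤ G.card.choose 2 := by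
  have hGg : G ⊆ gr M := (mem_planes.1 hG).1
  have h := sum_choose_linesOf hs hGg
  unfold prof
  rw [Multiset.map_map]
  have : (Multiset.map ((fun m => m.choose 2) ∘ fun L => (L ∩ G).card)
      ((linesOf M G).filter (fun L => 3 ≤ (L ∩ G).card)).val).sum =
      ∑ L ∈ (linesOf M G).filter (fun L => 3 ≤ (L ∩ G).card), ((L ∩ G).card).choose 2 := rfl
  rw [this, ← h]
  exact Finset.sum_le_sum_of_subset_of_nonneg (Finset.filter_subset _ _) (fun _ _ _ => Nat.zero_le _)

/-- Every profile entry is `≤ g − 1`, and `≥ 3`. -/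
theorem prof_mem_bounds {G : Finset α} (hG : G ∈ planes M) {m : ℕ} (hm : m ∈ prof M G) :
    3 ≤ m ∧ m + 1 ≤ G.card := by
  unfold prof at hm
  rw [Multiset.mem_map] at hm
  obtain ⟨L, hL, rfl⟩ := hm
  rw [Finset.mem_val, Finset.mem_filter] at hL
  exact ⟨hL.2, card_inter_le_of_linesOf (mem_planes.1 hG).2.2 hL.1⟩

/-- At most one line has more than `(g + 1) / 2` points: two such lines would share two points. -/
theorem prof_at_most_one_long (hs : Simple M) {G : Finset α} (hG : G ∈ planes M) :
    ((prof M G).filter (fun m => G.card + 1 < 2 * m)).card ≤ 1 := by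
  have hGg : G ⊆ gr M := (mem_planes.1 hG).1
  unfold prof
  rw [Multiset.filter_map, Multiset.card_map]
  -- the lines with more than `(g+1)/2` points form a finset of card `≤ 1`
  have : ((linesOf M G).filter (fun L => 3 ≤ (L ∩ G).card)).val.filter
      ((fun m => G.card + 1 < 2 * m) ∘ fun L => (L ∩ G).card) =
      (((linesOf M G).filter (fun L => 3 ≤ (L ∩ G).card)).filter
        (fun L => G.card + 1 < 2 * (L ∩ G).card)).val := rfl
  rw [this, Finset.card_val, Finset.card_le_one]
  intro L hL L' hL'
  rw [Finset.mem_filter, Finset.mem_filter] at hL hL'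
  by_contra hne
  -- `|L ∩ G| + |L' ∩ G| ≥ g + 2`, so the traces share `≥ 2` points
  have h := Finset.card_union_add_card_inter (L ∩ G) (L' ∩ G)
  have hun : ((L ∩ G) ∪ (L' ∩ G)).card ≤ G.card :=
    Finset.card_le_card (Finset.union_subset Finset.inter_subset_right Finset.inter_subset_right)
  have h2 : 2 ≤ (L ∩ G ∩ (L' ∩ G)).card := by omega
  obtain ⟨u, hu, v, hv, huv⟩ := Finset.one_lt_card.1 h2
  simp only [Finset.mem_inter] at hu hv
  exact hne (lines_eq_of_two_mem hs (Finset.mem_filter.1 hL.1.1).1 (Finset.mem_filter.1 hL'.1.1).1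
    hu.1.1 hv.1.1 hu.2.1 hv.2.1 huv)

/-- `N₃(G) = Σ_{s=3}^{g} N_s(g, prof)`. -/
theorem card_R3_eq_sum (hs : Simple M) {G : Finset α} (hG : G ∈ planes M) :
    (R3 M G).card = ∑ s ∈ Finset.Icc 3 G.card, Ns G.card (prof M G) s := by
  classical
  have hmaps : ∀ B ∈ R3 M G, B.card ∈ Finset.Icc 3 G.card := by
    intro B hB
    unfold R3 at hB
    rw [Finset.mem_filter, Finset.mem_powerset] at hB
    rw [Finset.mem_Icc]
    exact ⟨three_le_card_of_eRk_eq_three hB.2, Finset.card_le_card hB.1⟩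
  rw [Finset.card_eq_sum_card_fiberwise hmaps]
  apply Finset.sum_congr rfl
  intro s hs'
  rw [Finset.mem_Icc] at hs'
  rw [R3_filter_card, card_R3s hs hG hs'.1]

/-- At most one point `a ∈ G` has `ρ(G ∖ {a}) ≤ 2`, and only when `g − 1 ∈ prof` (`g ≥ 4`):
`g′ ≥ g − [g − 1 ∈ prof]`. -/
theorem gprime_ge (hs : Simple M) {G : Finset α} (hG : G ∈ planes M) (hg4 : 4 ≤ G.card) :
    G.card - (if G.card - 1 ∈ prof M G then 1 else 0) ≤
      (G.filter (fun a => M.eRk ((G.erase a : Finset α) : Set α) = 3)).card := by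
  classical
  have hGg : G ⊆ gr M := (mem_planes.1 hG).1
  have hG3 := (mem_planes.1 hG).2.2
  -- a bad point puts `G ∖ {a}` on a line of `g − 1` points
  have hbad : ∀ a ∈ G, ¬ M.eRk ((G.erase a : Finset α) : Set α) = 3 →
      ∃ L ∈ linesOf M G, (L ∩ G).card = G.card - 1 ∧ G.erase a ⊆ L := by
    intro a ha hne
    have hle : M.eRk ((G.erase a : Finset α) : Set α) ≤ 3 := by
      rw [← hG3]; exact M.eRk_mono (Finset.coe_subset.2 (Finset.erase_subset _ _))
    have hr2 : M.eRk ((G.erase a : Finset α) : Set α) = 2 := by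
      have hc : 2 ≤ (G.erase a).card := by rw [Finset.card_erase_of_mem ha]; omega
      obtain ⟨k, hk, -⟩ := eRk_eq_nat M (G.erase a)
      rw [hk] at hle hne ⊢
      have hk3 : k ≤ 3 := by exact_mod_cast hle
      have hk3' : k ≠ 3 := fun h => hne (by rw [h]; rfl)
      have hk2 : k ≤ 2 := by omega
      have h2 : (2 : ℕ∞) ≤ (k : ℕ∞) := by
        rw [← hk]
        obtain ⟨u, hu, v, hv, huv⟩ := Finset.one_lt_card.1 hc
        exact two_le_eRk_of_two_mem hs ((Finset.erase_subset _ _).trans hGg) hu hv huv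
      have hk2' : 2 ≤ k := by exact_mod_cast h2
      exact_mod_cast (show k = 2 by omega)
    obtain ⟨hL, hsub⟩ := clF_mem_lines ((Finset.erase_subset _ _).trans hGg) hr2
    refine ⟨clF M (G.erase a), ?_, ?_, hsub⟩
    · unfold linesOf
      rw [Finset.mem_filter]
      refine ⟨hL, ?_⟩
      calc 2 ≤ (G.erase a).card := by rw [Finset.card_erase_of_mem ha]; omega
        _ ≤ (clF M (G.erase a) ∩ G).card :=
          Finset.card_le_card (Finset.subset_inter hsub (Finset.erase_subset _ _))
    · apply le_antisymm
      · have := card_inter_le_of_linesOf hG3 (by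
          unfold linesOf; rw [Finset.mem_filter]
          refine ⟨hL, ?_⟩
          calc 2 ≤ (G.erase a).card := by rw [Finset.card_erase_of_mem ha]; omega
            _ ≤ (clF M (G.erase a) ∩ G).card :=
              Finset.card_le_card (Finset.subset_inter hsub (Finset.erase_subset _ _)))
        omega
      · calc G.card - 1 = (G.erase a).card := (Finset.card_erase_of_mem ha).symm
          _ ≤ (clF M (G.erase a) ∩ G).card :=
            Finset.card_le_card (Finset.subset_inter hsub (Finset.erase_subset _ _))
  -- the bad points number at most one, and exist only if `g − 1 ∈ prof`
  have hbadcard : (G.filter (fun a => ¬ M.eRk ((G.erase a : Finset α) : Set α) = 3)).card ≤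
      (if G.card - 1 ∈ prof M G then 1 else 0) := by
    split_ifs with hmem
    · rw [Finset.card_le_one]
      intro a ha b hb
      rw [Finset.mem_filter] at ha hb
      obtain ⟨L, hL, -, haL⟩ := hbad a ha.1 ha.2
      obtain ⟨L', hL', -, hbL'⟩ := hbad b hb.1 hb.2
      by_contra hab
      -- `G ∖ {a, b}` (≥ 2 points) lies on both lines, so `L = L'`, and then `G ⊆ L`
      have hsub : (G.erase a).erase b ⊆ L ∩ L' := by
        intro y hy
        rw [Finset.mem_erase, Finset.mem_erase] at hy
        rw [Finset.mem_inter]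
        exact ⟨haL (Finset.mem_erase.2 hy.2), hbL' (Finset.mem_erase.2 ⟨hy.1, hy.2.2⟩)⟩
      have hc : 2 ≤ ((G.erase a).erase b).card := by
        rw [Finset.card_erase_of_mem (Finset.mem_erase.2 ⟨Ne.symm hab, hb.1⟩), Finset.card_erase_of_mem ha.1]
        omega
      obtain ⟨u, hu, v, hv, huv⟩ := Finset.one_lt_card.1 hc
      have hLL' := lines_eq_of_two_mem hs (Finset.mem_filter.1 hL).1 (Finset.mem_filter.1 hL').1
        (Finset.mem_inter.1 (hsub hu)).1 (Finset.mem_inter.1 (hsub hv)).1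
        (Finset.mem_inter.1 (hsub hu)).2 (Finset.mem_inter.1 (hsub hv)).2 huv
      -- then `G ⊆ L`: `a ∈ G ∖ {b} ⊆ L' = L`
      have haL' : a ∈ L := by rw [hLL']; exact hbL' (Finset.mem_erase.2 ⟨hab, ha.1⟩)
      have hGL : G ⊆ L := by
        intro y hy
        by_cases hya : y = a
        · rw [hya]; exact haL'
        · exact haL (Finset.mem_erase.2 ⟨hya, hy⟩)
      have := M.eRk_mono (Finset.coe_subset.2 hGL)
      rw [hG3, (mem_lines.1 (Finset.mem_filter.1 hL).1).2.2] at this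
      exact absurd this (by decide)
    · apply Nat.le_of_eq
      rw [Finset.card_eq_zero, Finset.filter_eq_empty_iff]
      intro a ha hne
      obtain ⟨L, hL, hLc, -⟩ := hbad a ha hne
      apply hmem
      unfold prof
      rw [Multiset.mem_map]
      refine ⟨L, ?_, hLc⟩
      rw [Finset.mem_val, Finset.mem_filter]
      exact ⟨hL, by omega⟩
  have hsplit := Finset.card_filter_add_card_filter_not (s := G)
    (p := fun a => M.eRk ((G.erase a : Finset α) : Set α) = 3)
  omega

end SixThree

end PercRepro
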